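import Summits.QuantumFields.YangMills.Theorems.BalabanUVNodesN15KingModelGraphPowerCountingKing

/-!
# BalabanUVNodes ∕ N15 — THE KING-MODEL RUNG (PART Γ-d): PROPOSITION 3.6's POWER COUNTING FOR GENERAL GRAPHS — THE LOWERED EXPONENTS: «(3.70) gives
# L^{−γk}» (the `S^c` assignments are small by a power of the finest slice) and the letters of the replacement step's majorants (the (3.63)∕(3.73) profiles as
# slice majorants, «for γ small enough»)
# (Track A, DAG node N15 = NE2; FAN-OUT v1.1 §N15 s3 «KING-MODEL RUNG … NE2's analogue DECIDED in the model»)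

HONEST FRAMING.  Count-neutral (cell `pub-ymgap`, seat `pub-ymgap-dag-n15-e` g27; `--supports stmt-QuantumFields-27366 --as helper` = K3⁸
`SpineGivenEndpointR13SepCoPHV`).  TEMPLATE LITERATURE: C. King, *The U(1) Higgs model. I. The continuum limit*, Commun. Math. Phys. **102** (1986) 649–677
[King1986], proof of Proposition 3.6, pp. 663–665.  Parts Γ-a∕Γ-b∕Γ-c typed the power counting's SIZE half for general graphs (uniformly in the number of
scales); the RATE `L^{−γk}` of (3.56) needs two more ingredients, typed here generically ∕ as letters: (i) the assignments with a line in `S^c` (a slice finer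
than the coarse spacing) are small — the finest line's exponent is lowered by `γ` and the freed factor `(L^{j}η)^γ ≤ (L^{n₁−1}η)^γ` is the gain; (ii) the
majorants of the replacement step (part Η-c: the (3.63) size profile, the (3.73) reduced profile) as slice-indexed majorants with their sups and vertex sums,
and the monotonicity letters that let Prop. 3.9's printed `γ` serve every smaller `γ`.  Part Γ-e assembles (3.56) for general graphs.  King's U(1)∕`A = 0`
MODEL where King's objects appear; NOT Bałaban's non-abelian `G(U)` of [B9]; NOT a node discharge; nothing continuum ∕ ℝ⁴ ∕ OS ∕ mass-gap ∕ Clay.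
0 `sorry`; standard axioms.
THE PRINT.  p. 663 [PDF 15]: *«we write the decomposition of G^{η′}_{k+n} in the form G^{η′}_{k+n} = Σ_{j=−n}^{k−1} G^{η′}_{(j)} … (3.60) We divide the internal lines into
two sets S and S^c; in S all integers are zero or positive, while in S^c all integers are negative. (3.61)»*; p. 664 [PDF 16]: *«Consider first a term on the
right-hand side of (3.61) with S^c non-empty. … We continue doing this until S^c is exhausted, so that l(i+1) ∈ S. This gives Σ_{j=−n}^{−1} (L^{j−k})^{D(H_i)} ≤
C(L^{−γ(k+1)})·(L^{−(k+1)})^{D(H_i)−γ}. (3.70) For γ small enough, D(H_i) − γ > 0 and we continue the process … and (3.70) gives L^{−γk}»*; p. 665 [PDF 17]: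
*«Redoing the analysis, we see that the degrees of some subgraphs have been reduced by γ; for γ small enough, the exponents D(H_i) − γ are still positive»*.
WHAT THIS FILE PROVES (namespace `…N15KingModelRung.Curved`).
* §1 `sum_ofFn_lower`, ★ `posDegreesBy_ofFn_lower` (lowering ONE entry of an ordered exponent list by `γ ≥ 0`: `PosDegreesBy δ → PosDegreesBy (δ − γ)` — the
  `List.ofFn` form of part Ι-g `posDegreesBy_lower`), `posDegrees_ofFn_lower`, ★ `degConst_le_pow` (`PosDegreesBy δ`, `δ > 0` ⇒ `degConst L es ≤
  ((1 − L^{−δ})^{−1})^{|es|}` — the constant under a margin depends on the number of lines only), `length_ofFn_real`.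
* §2 `lowerFinest γ E` (the finest position's exponent lowered), `sliceProd_eq_finest_mul` (`Π_p s^{E_p} = s_{j_0}^γ·Π_p s^{E′_p}`), `apply_perm_zero_le` (along a
  monotone assignment the finest position is below every line); ★★ **`sum_graphValLS_slices_lt_le`** — THE `S^c` TERMS ARE SMALL (generic): with part Γ-b's
  hypotheses and `PosDegrees` of the finest-lowered lists, `Σ_{j : some line < n₁} 𝔼(H(j)) ≤ (L^{n₁−1}η)^γ·Γ·Cst^m·cV^n·(Σ_π degConst L (lowered list π))·Π q`.
* §3 `profileAt L k M C δ₀ c ex` (`C·(L^cη)^{ex}·e^{−δ₀(L^cη)^{−1}|x−y|∕L^k}`), `profileAt_nonneg`, ★ `profileAt_le_sup`, `lineSum_profileAt_row`∕`_col` ((3.68), part Ι-c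
  `lineSum_profile_le` + `tdistT_symm`), ★ `rate_profileAt_mono` (`L^{−γ_Bk}·profile(ex − γ_B) ≤ L^{−γk}·profile(ex − γ)` for `γ ≤ γ_B` — «for γ small enough»),
  readings `kingSizeProfile_eq_profileAt`, `kingReducedProfile_eq_profileAt`, `kingLoLine_eq_sliceLine`, `kingHiLine_eq_sliceLine` (part Η-c's kernels = the run
  data's `sliceLine`, the fine one at slice `jl + n` per (3.60)); `graphValLS_mono` (the majorant graph is monotone in nonnegative majorants).
HONEST SCOPE.  (a) Letters and the generic `S^c` lemma; the assembly of (3.56) for general graphs is part Γ-e.  (b) Positivity of the (lowered) degrees is a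
hypothesis (§3.5 ∕ Thm 3.5 NOT typed).  (c) King's model objects only in §3's readings (parts Η-c ∕ Ι-c by name).  Locators: [King1986] (3.60)–(3.61) p.663,
(3.66) p.663 (foot), (3.67)–(3.70) p.664, p.665, (3.63) p.663, (3.73) p.665.
-/
noncomputable section

namespace Summit.QuantumFields.YangMills.BalabanUVNodes.N15KingModelRung.Curved

open scoped BigOperators
open Finset
open Literature.MathematicalPhysics.QuantumFieldTheory.Balaban1983to89.B5Prop11Plancherel (Tor fine unitVec)
open Literature.MathematicalPhysics.QuantumFieldTheory.King1986.Torus (tdistT tdistT_nonneg tdistT_symm)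
open Literature.MathematicalPhysics.QuantumFieldTheory.King1986.ContinuumLimit (eps)
open Summit.QuantumFields.YangMills.BalabanUVNodes.N15KingModelRung (KingVolIndex kingVol kingVol_neZero)
open Summit.QuantumFields.YangMills.BalabanUVNodes.N15KingModelRung.Graph

variable (L : ℕ)

/-! ## §1 Lowering one exponent of an `ofFn` list; the degree constant under a margin -/

section ListLetters

omit L in
/-- `(List.ofFn f).sum = Σ_p f p` with one entry lowered by `γ`: the total drops by `γ`. [folklore] -/
theorem sum_ofFn_lower {m : ℕ} (f : Fin m → ℝ) (p₀ : Fin m) (γ : ℝ) :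
    (List.ofFn fun p => f p - if p = p₀ then γ else 0).sum = (List.ofFn f).sum - γ := by
  rw [List.sum_ofFn, List.sum_ofFn, sum_sub_distrib, Fintype.sum_ite_eq']

omit L in
/-- ★ **LOWERING ONE EXPONENT OF AN ORDERED LIST BY γ KEEPS THE PARTIAL DEGREES ABOVE `δ − γ`** (the `List.ofFn` form of part Ι-g `posDegreesBy_lower`:
King p. 665 *«the degrees of some subgraphs have been reduced by γ; for γ small enough, the exponents D(H_i) − γ are still positive»*).
[cite: King1986, p.665 (proof of Prop. 3.6)] -/
theorem posDegreesBy_ofFn_lower {δ γ : ℝ} (hγ : 0 ≤ γ) :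
    ∀ {m : ℕ} (f : Fin m → ℝ) (p₀ : Fin m), PosDegreesBy δ (List.ofFn f) → PosDegreesBy (δ - γ) (List.ofFn fun p => f p - if p = p₀ then γ else 0)
  | 0, _, p₀, _ => Fin.elim0 p₀
  | m + 1, f, p₀, h => by
      rw [List.ofFn_succ] at h ⊢
      obtain ⟨h1, h2⟩ := h
      refine ⟨?_, ?_⟩
      · -- the total degree drops by at most `γ`
        have hs : (f 0 - if (0 : Fin (m + 1)) = p₀ then γ else 0) + (List.ofFn fun i : Fin m => f i.succ - if i.succ = p₀ then γ else 0).sum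
            = (f 0 + (List.ofFn fun i : Fin m => f i.succ).sum) - γ := by
          have e1 := sum_ofFn_lower f p₀ γ
          rw [List.ofFn_succ, List.ofFn_succ, List.sum_cons, List.sum_cons] at e1
          exact e1
        rw [hs]; linarith
      · -- the tail: unchanged if `p₀ = 0`, lowered at `p₀ − 1` otherwise
        rcases Fin.eq_zero_or_eq_succ p₀ with rfl | ⟨p₁, rfl⟩
        · have ht : (List.ofFn fun i : Fin m => f i.succ - if i.succ = (0 : Fin (m + 1)) then γ else 0) = List.ofFn fun i : Fin m => f i.succ := by
            congr 1; funext i; rw [if_neg (Fin.succ_ne_zero i), sub_zero]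
          rw [ht]
          exact posDegreesBy_mono (by linarith) h2
        · have ht : (List.ofFn fun i : Fin m => f i.succ - if i.succ = p₁.succ then γ else 0)
              = List.ofFn fun i : Fin m => (fun i => f i.succ) i - if i = p₁ then γ else 0 := by
            congr 1; funext i
            by_cases hi : i = p₁
            · subst hi; simp
            · rw [if_neg hi, if_neg (fun h => hi (Fin.succ_injective _ h))]
          rw [ht]
          exact posDegreesBy_ofFn_lower hγ (fun i => f i.succ) p₁ h2

omit L in
/-- lowering one exponent by `γ ≤ δ` keeps `PosDegrees` (margin `δ − γ ≥ 0`). [cite: King1986, p.665] -/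
theorem posDegrees_ofFn_lower {δ γ : ℝ} (hγ : 0 ≤ γ) (hγδ : γ ≤ δ) {m : ℕ} (f : Fin m → ℝ) (p₀ : Fin m) (h : PosDegreesBy δ (List.ofFn f)) :
    PosDegrees (List.ofFn fun p => f p - if p = p₀ then γ else 0) :=
  posDegrees_of_posDegreesBy (by linarith) (posDegreesBy_ofFn_lower hγ f p₀ h)

/-- ★ **THE DEGREE CONSTANT UNDER A MARGIN**: if every partial degree exceeds `δ > 0`, then `degConst L es ≤ ((1 − L^{−δ})^{−1})^{|es|}` (`L ≥ 2`; part Ι-c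
`geomConst_mono`) — a bound «depending only on n̄» once the margin is fixed. [cite: King1986, (3.69)–(3.70) p.664 («bounded by C»)] -/
theorem degConst_le_pow (hL : 2 ≤ L) {δ : ℝ} (hδ : 0 < δ) : ∀ {es : List ℝ}, PosDegreesBy δ es → degConst L es ≤ ((1 - (L : ℝ) ^ (-δ))⁻¹) ^ es.length
  | [], _ => by simp [degConst]
  | e :: es, h => by
      have h1 : (1 - (L : ℝ) ^ (-(e + es.sum)))⁻¹ ≤ (1 - (L : ℝ) ^ (-δ))⁻¹ := geomConst_mono L hL hδ h.1.le
      have h2 := degConst_le_pow hL hδ h.2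
      have h0 : 0 ≤ degConst L es := zero_le_one.trans (one_le_degConst L hL (posDegrees_of_posDegreesBy hδ.le h.2))
      have hg0 : 0 ≤ (1 - (L : ℝ) ^ (-(e + es.sum)))⁻¹ := by
        obtain ⟨-, hx1, -⟩ := sliceBase_lt_one hL (hδ.trans h.1)
        exact inv_nonneg.2 (by linarith)
      unfold degConst
      rw [List.length_cons, pow_succ, mul_comm (((1 - (L : ℝ) ^ (-δ))⁻¹) ^ es.length)]
      exact mul_le_mul h1 h2 h0 ((hg0.trans h1))

omit L in
/-- the length of an order list. [folklore] -/
theorem length_ofFn_real {m : ℕ} (f : Fin m → ℝ) : (List.ofFn f).length = m := List.length_ofFn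

end ListLetters

/-! ## §2 The `S^c` assignments: a line below the threshold forces the finest position below it ⇒ the factor `(L^{n₁−1}η)^γ` -/

section Finest
variable {S : Type*} [Fintype S] [Nonempty S] {Υ : Type*} [Fintype Υ] [DecidableEq Υ]
variable {n m : ℕ} {src tgt : Fin m → Fin (n + 1)}

omit L in
/-- **the exponents with the FINEST position lowered by γ** (King's extraction of `L^{−γk}` from the `S^c` lines, (3.70)). [cite: King1986, (3.70) p.664] -/
def lowerFinest (γ : ℝ) (E : Fin m → ℝ) : Fin m → ℝ := fun p => E p - if (p : ℕ) = 0 then γ else 0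

/-- splitting off the finest line's extra power: `Π_p s_{j_p}^{E_p} = s_{j_0}^γ·Π_p s_{j_p}^{E′_p}` (`E′ = lowerFinest γ E`, `m ≥ 1`). [cite: King1986, (3.70) p.664] -/
theorem sliceProd_eq_finest_mul (K : ℕ) (hL1 : 1 ≤ L) (hm : 0 < m) (γ : ℝ) (E : Fin m → ℝ) (j : Fin m → Fin K) :
    sliceProd L K E j = ((L : ℝ) ^ ((j ⟨0, hm⟩ : ℕ)) * eps L K) ^ γ * sliceProd L K (lowerFinest γ E) j := by
  have hL0 : (0 : ℝ) < L := by exact_mod_cast (show 0 < L by omega)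
  have hs : ∀ p, 0 < (L : ℝ) ^ ((j p : ℕ)) * eps L K := fun p => by unfold eps; positivity
  unfold sliceProd lowerFinest
  have h1 : ∀ p : Fin m, ((L : ℝ) ^ ((j p : ℕ)) * eps L K) ^ E p
      = ((L : ℝ) ^ ((j p : ℕ)) * eps L K) ^ (E p - if (p : ℕ) = 0 then γ else 0)
          * ((L : ℝ) ^ ((j p : ℕ)) * eps L K) ^ (if p = ⟨0, hm⟩ then γ else 0) := by
    intro p
    rw [← Real.rpow_add (hs p)]
    congr 1
    by_cases hp : p = ⟨0, hm⟩
    · subst hp; simp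
    · rw [if_neg hp, if_neg (fun h => hp (Fin.ext h))]; ring
  have h2 : ∏ p : Fin m, ((L : ℝ) ^ ((j p : ℕ)) * eps L K) ^ (if p = ⟨0, hm⟩ then γ else 0) = ((L : ℝ) ^ ((j ⟨0, hm⟩ : ℕ)) * eps L K) ^ γ := by
    rw [Fintype.prod_eq_single ⟨0, hm⟩ fun p hp => by rw [if_neg hp, Real.rpow_zero], if_pos rfl]
  rw [prod_congr rfl fun p _ => h1 p, prod_mul_distrib, h2]
  ring

/-- along a monotone assignment the finest position is below every line's slice. [folklore] -/
theorem apply_perm_zero_le {K : ℕ} (hm : 0 < m) (π : Equiv.Perm (Fin m)) (j : Fin m → Fin K) (hmono : Monotone (j ∘ ⇑π)) (ℓ : Fin m) :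
    j (π ⟨0, hm⟩) ≤ j ℓ := by
  have h := hmono (show (⟨0, hm⟩ : Fin m) ≤ π.symm ℓ from Fin.mk_le_of_le_val (Nat.zero_le _))
  simpa only [Function.comp_apply, Equiv.apply_symm_apply] using h

/-- ★★ **THE `S^c` TERMS ARE SMALL — the generic form of (3.70)'s «gives L^{−γk}»**: with the hypotheses of part Γ-b `sum_graphValLS_slices_le`, a threshold
`1 ≤ n₁ ≤ K`, `γ ≥ 0`, and positive partial degrees of the exponent lists WITH THE FINEST POSITION LOWERED BY γ, the sum of the majorant graph values over
the assignments having SOME line below the threshold is bounded by `(L^{n₁−1}η)^γ` times the uniform constant: along an ordering such an assignment has its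
finest line below `n₁`, and `s_{j_{l(1)}}^{E_1} = s_{j_{l(1)}}^γ·s_{j_{l(1)}}^{E_1−γ} ≤ (L^{n₁−1}η)^γ·s^{E_1−γ}` — King: *«We continue doing this until S^c is exhausted …
(3.70) … and (3.70) gives L^{−γk}»* (in the fine run `K = k + n`, `n₁ = n`: `(L^{n−1}η′)^γ = L^{−γ(k+1)}`).
[cite: King1986, (3.60)–(3.61) p.663, (3.70) p.664] -/
theorem sum_graphValLS_slices_lt_le (hL : 2 ≤ L) {K : ℕ} (hK : 1 ≤ K) (vtx : Υ → Fin (n + 1)) {ω : ℝ} (hω : 0 ≤ ω)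
    (P : Fin m → Fin K → S → S → ℝ) (hP0 : ∀ ℓ c x y, 0 ≤ P ℓ c x y) {Cst cV : ℝ} (hCst : 0 ≤ Cst) (hcV : 0 ≤ cV) (dV : ℝ) (e : Fin m → ℝ)
    (hsup : ∀ ℓ c x y, P ℓ c x y ≤ Cst * ((L : ℝ) ^ ((c : ℕ)) * eps L K) ^ e ℓ)
    (hrow : ∀ ℓ c y, ∑ a, ω * P ℓ c y a ≤ Cst * cV * ((L : ℝ) ^ ((c : ℕ)) * eps L K) ^ (e ℓ + dV))
    (hcol : ∀ ℓ c y, ∑ a, ω * P ℓ c a y ≤ Cst * cV * ((L : ℝ) ^ ((c : ℕ)) * eps L K) ^ (e ℓ + dV))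
    (p : Υ → S → ℝ) (hp0 : ∀ υ x, 0 ≤ p υ x) (υ₀ : Υ) (hυ₀ : vtx υ₀ = 0) {Γ : ℝ} (hΓ : ∑ x, ω * p υ₀ x ≤ Γ)
    (q : Υ → ℝ) (hq : ∀ υ, υ ≠ υ₀ → ∀ x, p υ x ≤ q υ)
    (cert : Equiv.Perm (Fin m) → ForestCert n src tgt) {γ : ℝ} (hγ : 0 ≤ γ) {n₁ : ℕ} (hn₁ : 1 ≤ n₁)
    (hpos : ∀ π, PosDegrees (List.ofFn fun p : Fin m => lowerFinest γ (orderExps dV e π (cert π)) (Fin.rev p))) :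
    ∑ j : Fin m → Fin K, (if ∃ ℓ, ((j ℓ : ℕ)) < n₁ then graphValLS ω src tgt (fun ℓ => P ℓ (j ℓ)) vtx p else 0)
      ≤ ((L : ℝ) ^ (n₁ - 1) * eps L K) ^ γ * (Γ * (Cst ^ m * cV ^ n
          * (∑ π : Equiv.Perm (Fin m), degConst L (List.ofFn fun p : Fin m => lowerFinest γ (orderExps dV e π (cert π)) (Fin.rev p)))
          * ∏ υ ∈ univ.erase υ₀, q υ)) := by
  classical
  obtain ⟨x₀⟩ := ‹Nonempty S›
  have hL1 : 1 ≤ L := by omega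
  have hL0 : (0 : ℝ) < L := by exact_mod_cast (show 0 < L by omega)
  have hΓ0 : 0 ≤ Γ := (sum_nonneg fun x _ => mul_nonneg hω (hp0 _ _)).trans hΓ
  have hq0 : 0 ≤ ∏ υ ∈ univ.erase υ₀, q υ := prod_nonneg fun υ hυ => (hp0 υ x₀).trans (hq υ (ne_of_mem_erase hυ) x₀)
  set B : ℝ := Γ * (Cst ^ m * cV ^ n * ∏ υ ∈ univ.erase υ₀, q υ) with hB
  have hB0 : 0 ≤ B := mul_nonneg hΓ0 (mul_nonneg (mul_nonneg (pow_nonneg hCst _) (pow_nonneg hcV _)) hq0)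
  set θ : ℝ := ((L : ℝ) ^ (n₁ - 1) * eps L K) ^ γ with hθ
  have hθ0 : 0 ≤ θ := Real.rpow_nonneg (by unfold eps; positivity) _
  have hdc0 : ∀ π : Equiv.Perm (Fin m), 0 ≤ degConst L (List.ofFn fun p : Fin m => lowerFinest γ (orderExps dV e π (cert π)) (Fin.rev p)) :=
    fun π => zero_le_one.trans (one_le_degConst L hL (hpos π))
  -- no lines: nothing is below the threshold
  rcases Nat.eq_zero_or_pos m with hm0 | hm
  · subst hm0
    have h0 : ∀ j : Fin 0 → Fin K, ¬ ∃ ℓ, ((j ℓ : ℕ)) < n₁ := fun j ⟨ℓ, _⟩ => Fin.elim0 ℓ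
    rw [sum_congr rfl fun j _ => if_neg (h0 j), sum_const_zero]
    exact mul_nonneg hθ0 (mul_nonneg hΓ0 (mul_nonneg (mul_nonneg (mul_nonneg (pow_nonneg hCst _) (pow_nonneg hcV _))
      (sum_nonneg fun π _ => hdc0 π)) hq0))
  -- per `(π, j)`: part Γ-a with the slice majorants, then the finest factor
  have hG0 : ∀ j : Fin m → Fin K, 0 ≤ graphValLS ω src tgt (fun ℓ => P ℓ (j ℓ)) vtx p := fun j =>
    graphValLS_nonneg' src tgt vtx hω _ (fun ℓ => hP0 ℓ _) p hp0
  have hper : ∀ (π : Equiv.Perm (Fin m)) (j : Fin m → Fin K), Monotone (j ∘ ⇑π) → (∃ ℓ, ((j ℓ : ℕ)) < n₁) →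
      graphValLS ω src tgt (fun ℓ => P ℓ (j ℓ)) vtx p ≤ θ * (B * sliceProd L K (lowerFinest γ (orderExps dV e π (cert π))) (j ∘ ⇑π)) := by
    intro π j hmono hex
    obtain ⟨ℓ, hℓ⟩ := hex
    have h := graphValLS_le_of_forestCert (cert π) vtx hω (fun ℓ => P ℓ (j ℓ)) (fun ℓ => hP0 ℓ _) p hp0
      (fun ℓ => Cst * ((L : ℝ) ^ ((j ℓ : ℕ)) * eps L K) ^ e ℓ) (fun ℓ _ x y => hsup ℓ _ x y)
      (fun i => Cst * cV * ((L : ℝ) ^ ((j ((cert π).tl i) : ℕ)) * eps L K) ^ (e ((cert π).tl i) + dV))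
      (fun i y => hrow _ _ y) (fun i y => hcol _ _ y) υ₀ hυ₀ hΓ q hq
    rw [lineConstants_eq L K (cert π) π Cst cV dV e j, sliceProd_eq_finest_mul L K hL1 hm γ] at h
    -- the finest factor
    have hfin : ((L : ℝ) ^ (((j ∘ ⇑π) ⟨0, hm⟩ : ℕ)) * eps L K) ^ γ ≤ θ := by
      refine Real.rpow_le_rpow (by unfold eps; positivity) ?_ hγ
      refine mul_le_mul_of_nonneg_right (pow_le_pow_right₀ (by exact_mod_cast hL1) ?_) (by unfold eps; positivity)
      have h1 : ((j (π ⟨0, hm⟩) : ℕ)) ≤ (j ℓ : ℕ) := apply_perm_zero_le hm π j hmono ℓ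
      show ((j (π ⟨0, hm⟩) : ℕ)) ≤ n₁ - 1
      omega
    have hsp0 : 0 ≤ sliceProd L K (lowerFinest γ (orderExps dV e π (cert π))) (j ∘ ⇑π) :=
      prod_nonneg fun p _ => Real.rpow_nonneg (by unfold eps; positivity) _
    refine h.trans ?_
    calc Γ * (Cst ^ m * cV ^ n * (((L : ℝ) ^ (((j ∘ ⇑π) ⟨0, hm⟩ : ℕ)) * eps L K) ^ γ
            * sliceProd L K (lowerFinest γ (orderExps dV e π (cert π))) (j ∘ ⇑π)) * ∏ υ ∈ univ.erase υ₀, q υ)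
        = ((L : ℝ) ^ (((j ∘ ⇑π) ⟨0, hm⟩ : ℕ)) * eps L K) ^ γ * (B * sliceProd L K (lowerFinest γ (orderExps dV e π (cert π))) (j ∘ ⇑π)) := by
          rw [hB]; ring
      _ ≤ θ * (B * sliceProd L K (lowerFinest γ (orderExps dV e π (cert π))) (j ∘ ⇑π)) :=
          mul_le_mul_of_nonneg_right hfin (mul_nonneg hB0 hsp0)
  -- (3.58): orderings
  have hF0 : ∀ j : Fin m → Fin K, 0 ≤ (if ∃ ℓ, ((j ℓ : ℕ)) < n₁ then graphValLS ω src tgt (fun ℓ => P ℓ (j ℓ)) vtx p else 0) := fun j => by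
    split_ifs
    · exact hG0 j
    · exact le_rfl
  refine (sum_le_sum_perm_monotone (β := Fin K) _ hF0).trans ?_
  have hdc : ∀ π : Equiv.Perm (Fin m),
      ∑ j : Fin m → Fin K, (if Monotone (j ∘ ⇑π) then
          (if ∃ ℓ, ((j ℓ : ℕ)) < n₁ then graphValLS ω src tgt (fun ℓ => P ℓ (j ℓ)) vtx p else 0) else 0)
        ≤ θ * (B * degConst L (List.ofFn fun p : Fin m => lowerFinest γ (orderExps dV e π (cert π)) (Fin.rev p))) := by
    intro π
    calc ∑ j : Fin m → Fin K, (if Monotone (j ∘ ⇑π) then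
            (if ∃ ℓ, ((j ℓ : ℕ)) < n₁ then graphValLS ω src tgt (fun ℓ => P ℓ (j ℓ)) vtx p else 0) else 0)
        ≤ ∑ j : Fin m → Fin K, (if Monotone (j ∘ ⇑π) then
            θ * (B * sliceProd L K (lowerFinest γ (orderExps dV e π (cert π))) (j ∘ ⇑π)) else 0) := by
          refine sum_le_sum fun j _ => ?_
          split_ifs with h1 h2
          · exact hper π j h1 h2
          · exact mul_nonneg hθ0 (mul_nonneg hB0 (prod_nonneg fun p _ => Real.rpow_nonneg (by unfold eps; positivity) _))
          · exact le_rfl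
      _ = θ * (B * ∑ j : Fin m → Fin K, (if Monotone j then sliceProd L K (lowerFinest γ (orderExps dV e π (cert π))) j else 0)) := by
          rw [mul_sum, mul_sum, ← sum_comp_perm_eq π (fun j : Fin m → Fin K =>
            θ * (B * (if Monotone j then sliceProd L K (lowerFinest γ (orderExps dV e π (cert π))) j else 0)))]
          refine sum_congr rfl fun j _ => ?_
          split_ifs <;> simp
      _ = θ * (B * nestedSliceSum L K (List.ofFn fun p : Fin m => lowerFinest γ (orderExps dV e π (cert π)) (Fin.rev p)) (K - 1)) := by
          rw [sum_monotone_sliceProd_eq_top L hK]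
      _ ≤ θ * (B * degConst L (List.ofFn fun p : Fin m => lowerFinest γ (orderExps dV e π (cert π)) (Fin.rev p))) :=
          mul_le_mul_of_nonneg_left (mul_le_mul_of_nonneg_left (nestedSliceSum_le_degConst L hL K (hpos π) (by omega)) hB0) hθ0
  refine (sum_le_sum fun π _ => hdc π).trans (le_of_eq ?_)
  rw [← mul_sum, ← mul_sum, hB]
  ring

end Finest

/-! ## §3 Letters for the rate: the (3.63)∕(3.73) profiles as slice majorants, monotonicity of the majorant graph -/

section Profiles
variable {d : ℕ} [NeZero L]

/-- **THE (3.63)∕(3.73)-TYPE PROFILE at slice `c` with a real exponent `ex`** on `T_η = Tor (fine (L^k) M)`: `C·(L^cη)^{ex}·exp[−δ₀(L^cη)^{−1}|x − y|∕L^k]` (parts Η-b∕Η-c's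
`sizeProfile`∕`reducedProfile` read in the torus' letters: `kingSizeProfile_eq_profileAt`, `kingReducedProfile_eq_profileAt`). [cite: King1986, (3.63) p.663, (3.73) p.665] -/
def profileAt (k : ℕ) (M : Fin (d + 1) → ℕ) [∀ μ, NeZero (M μ)] (C δ₀ : ℝ) (c : ℕ) (ex : ℝ) (x y : Tor (fine (L ^ k) M)) : ℝ :=
  C * ((L : ℝ) ^ c * eps L k) ^ ex * Real.exp (-(δ₀ * ((L : ℝ) ^ c * eps L k)⁻¹ * (tdistT (fine (L ^ k) M) x y / (L : ℝ) ^ k)))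

/-- the profile is nonnegative (`C ≥ 0`). [folklore] -/
theorem profileAt_nonneg {k : ℕ} (M : Fin (d + 1) → ℕ) [∀ μ, NeZero (M μ)] {C : ℝ} (hC : 0 ≤ C) (δ₀ : ℝ) (c : ℕ) (ex : ℝ) (x y : Tor (fine (L ^ k) M)) :
    0 ≤ profileAt L k M C δ₀ c ex x y := by
  have hL0 : (0 : ℝ) < L := by exact_mod_cast Nat.pos_of_ne_zero (NeZero.ne L)
  unfold profileAt
  exact mul_nonneg (mul_nonneg hC (Real.rpow_nonneg (by unfold eps; positivity) _)) (Real.exp_nonneg _)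

/-- **the profile's sup**: `≤ C·(L^cη)^{ex}` (the decay dropped; `δ₀ ≥ 0`). [cite: King1986, (3.63) p.663] -/
theorem profileAt_le_sup {k : ℕ} (M : Fin (d + 1) → ℕ) [∀ μ, NeZero (M μ)] {C δ₀ : ℝ} (hC : 0 ≤ C) (hδ₀ : 0 ≤ δ₀) (c : ℕ) (ex : ℝ)
    (x y : Tor (fine (L ^ k) M)) : profileAt L k M C δ₀ c ex x y ≤ C * ((L : ℝ) ^ c * eps L k) ^ ex := by
  have hL0 : (0 : ℝ) < L := by exact_mod_cast Nat.pos_of_ne_zero (NeZero.ne L)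
  have hs : 0 < (L : ℝ) ^ c * eps L k := by unfold eps; positivity
  have hexp : Real.exp (-(δ₀ * ((L : ℝ) ^ c * eps L k)⁻¹ * (tdistT (fine (L ^ k) M) x y / (L : ℝ) ^ k))) ≤ 1 := by
    rw [Real.exp_le_one_iff, neg_nonpos]
    exact mul_nonneg (mul_nonneg hδ₀ (inv_nonneg.2 hs.le)) (div_nonneg (tdistT_nonneg _ x y) (pow_nonneg hL0.le _))
  unfold profileAt
  exact (mul_le_mul_of_nonneg_left hexp (mul_nonneg hC (Real.rpow_nonneg hs.le _))).trans (le_of_eq (mul_one _))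

/-- **the profile's row sum by (3.68)** (part Ι-c `lineSum_profile_le`): `Σ_y η^{d+1}·profile(x, y) ≤ C·c368·(L^cη)^{ex + (d+1)}`. [cite: King1986, (3.68) p.664] -/
theorem lineSum_profileAt_row (hL : 1 ≤ L) {k : ℕ} (M : Fin (d + 1) → ℕ) [∀ μ, NeZero (M μ)] {C δ₀ : ℝ} (hC : 0 ≤ C) (hδ₀ : 0 < δ₀) (c : ℕ) (ex : ℝ)
    (x : Tor (fine (L ^ k) M)) :
    ∑ y, (((L : ℝ) ^ k)⁻¹) ^ (d + 1) * profileAt L k M C δ₀ c ex x y ≤ C * c368 d δ₀ * ((L : ℝ) ^ c * eps L k) ^ (ex + ((d + 1 : ℕ) : ℝ)) :=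
  lineSum_profile_le L hL hC hδ₀ k c M ex x

/-- **the profile's column sum** (`tdistT_symm`). [cite: King1986, (3.68) p.664] -/
theorem lineSum_profileAt_col (hL : 1 ≤ L) {k : ℕ} (M : Fin (d + 1) → ℕ) [∀ μ, NeZero (M μ)] {C δ₀ : ℝ} (hC : 0 ≤ C) (hδ₀ : 0 < δ₀) (c : ℕ) (ex : ℝ)
    (y : Tor (fine (L ^ k) M)) :
    ∑ x, (((L : ℝ) ^ k)⁻¹) ^ (d + 1) * profileAt L k M C δ₀ c ex x y ≤ C * c368 d δ₀ * ((L : ℝ) ^ c * eps L k) ^ (ex + ((d + 1 : ℕ) : ℝ)) := by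
  have h : ∀ x, profileAt L k M C δ₀ c ex x y = profileAt L k M C δ₀ c ex y x := fun x => by
    unfold profileAt; rw [tdistT_symm _ x y]
  simp_rw [h]
  exact lineSum_profile_le L hL hC hδ₀ k c M ex y

/-- ★ **LOWERING BY LESS COSTS LESS**: for `γ ≤ γ_B` and `L ≥ 1`, `L^{−γ_Bk}·profile(ex − γ_B) ≤ L^{−γk}·profile(ex − γ)` — (3.73)'s gain against the lowered
exponent nets `L^{−γ_B j} ≤ L^{−γ j}` (part Η-b `lineRatio_eq`), so Prop. 3.9 at the printed `γ` serves every smaller `γ` («for γ small enough»).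
[cite: King1986, p.665 («for γ small enough, the exponents D(H_i) − γ are still positive»), (3.73) p.665] -/
theorem rate_profileAt_mono {k : ℕ} (M : Fin (d + 1) → ℕ) [∀ μ, NeZero (M μ)] {C δ₀ : ℝ} (hC : 0 ≤ C) {γ γB : ℝ} (hγB : γ ≤ γB)
    (c : ℕ) (ex : ℝ) (x y : Tor (fine (L ^ k) M)) :
    (L : ℝ) ^ (-(γB * k)) * profileAt L k M C δ₀ c (ex - γB) x y ≤ (L : ℝ) ^ (-(γ * k)) * profileAt L k M C δ₀ c (ex - γ) x y := by
  have hL1 : (1 : ℝ) ≤ L := by exact_mod_cast Nat.one_le_iff_ne_zero.2 (NeZero.ne L)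
  have hL0 : (0 : ℝ) < L := by linarith
  have hkey : (L : ℝ) ^ (-(γB * k)) * ((L : ℝ) ^ c * eps L k) ^ (ex - γB) ≤ (L : ℝ) ^ (-(γ * k)) * ((L : ℝ) ^ c * eps L k) ^ (ex - γ) := by
    rw [slice_rpow_eq L hL0 c k (ex - γB), slice_rpow_eq L hL0 c k (ex - γ), ← Real.rpow_add hL0, ← Real.rpow_add hL0]
    refine Real.rpow_le_rpow_of_exponent_le hL1 ?_
    nlinarith [mul_nonneg (sub_nonneg.2 hγB) (Nat.cast_nonneg c)]
  unfold profileAt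
  have hE : 0 ≤ Real.exp (-(δ₀ * ((L : ℝ) ^ c * eps L k)⁻¹ * (tdistT (fine (L ^ k) M) x y / (L : ℝ) ^ k))) := Real.exp_nonneg _
  calc (L : ℝ) ^ (-(γB * k)) * (C * ((L : ℝ) ^ c * eps L k) ^ (ex - γB)
          * Real.exp (-(δ₀ * ((L : ℝ) ^ c * eps L k)⁻¹ * (tdistT (fine (L ^ k) M) x y / (L : ℝ) ^ k))))
      = C * ((L : ℝ) ^ (-(γB * k)) * ((L : ℝ) ^ c * eps L k) ^ (ex - γB))
          * Real.exp (-(δ₀ * ((L : ℝ) ^ c * eps L k)⁻¹ * (tdistT (fine (L ^ k) M) x y / (L : ℝ) ^ k))) := by ring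
    _ ≤ C * ((L : ℝ) ^ (-(γ * k)) * ((L : ℝ) ^ c * eps L k) ^ (ex - γ))
          * Real.exp (-(δ₀ * ((L : ℝ) ^ c * eps L k)⁻¹ * (tdistT (fine (L ^ k) M) x y / (L : ℝ) ^ k))) :=
        mul_le_mul_of_nonneg_right (mul_le_mul_of_nonneg_left hkey hC) hE
    _ = _ := by ring

/-- reading: part Η-c's size profile is `profileAt` at the exponent `lineExp κ`. [cite: King1986, (3.63) p.663] -/
theorem kingSizeProfile_eq_profileAt (a msq : ℝ) (j : KingVolIndex d) (n : ℕ) (C δ₀ : ℝ) (jl : ℕ) (κ : Option (Fin (d + 1)))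
    (x y : haveI := kingVol_neZero L j; Tor (fine (L ^ j.K) (kingVol L j))) :
    haveI := kingVol_neZero L j
    kingSizeProfile L a msq j n C δ₀ jl κ x y = profileAt L j.K (kingVol L j) C δ₀ jl (lineExp (d + 1) κ) x y := rfl

/-- reading: part Η-c's reduced profile is `profileAt` at the exponent `lineExp κ − γ`. [cite: King1986, (3.73) p.665] -/
theorem kingReducedProfile_eq_profileAt (a msq : ℝ) (j : KingVolIndex d) (n : ℕ) (C δ₀ γ : ℝ) (jl : ℕ) (κ : Option (Fin (d + 1)))
    (x y : haveI := kingVol_neZero L j; Tor (fine (L ^ j.K) (kingVol L j))) :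
    haveI := kingVol_neZero L j
    kingReducedProfile L a msq j n C δ₀ γ jl κ x y = profileAt L j.K (kingVol L j) C δ₀ jl (lineExp (d + 1) κ - γ) x y := rfl

/-- reading: part Η-c's coarse line kernel is the `K`-run datum's `sliceLine`. [cite: King1986, (2.17) p.653] -/
theorem kingLoLine_eq_sliceLine (a msq : ℝ) (j : KingVolIndex d) (n : ℕ) (jl : ℕ) (κ : Option (Fin (d + 1)))
    (x y : haveI := kingVol_neZero L j; Tor (fine (L ^ j.K) (kingVol L j))) :
    haveI := kingVol_neZero L j
    kingLoLine L a msq j n jl κ x y = sliceLine (kingSliceKernels L j.K j.m (kingVol L j) (fun _ => rfl) j.one_le_K a msq) jl κ x y := by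
  cases κ <;> rfl

/-- reading: part Η-c's fine line kernel at slice `jl` is the `(K+n)`-run datum's `sliceLine` at slice `jl + n` ((3.60)'s re-indexing). [cite: King1986, (3.60) p.663] -/
theorem kingHiLine_eq_sliceLine (a msq : ℝ) (j : KingVolIndex d) (n : ℕ) (jl : ℕ) (κ : Option (Fin (d + 1)))
    (x' y' : haveI := kingVol_neZero L j; Tor (fine (L ^ (j.K + n)) (kingVol L j))) :
    haveI := kingVol_neZero L j
    kingHiLine L a msq j n jl κ x' y'
      = sliceLine (kingSliceKernels L (j.K + n) j.m (kingVol L j) (fun _ => rfl) (one_le_add_of_one_le j.one_le_K n) a msq) (jl + n) κ x' y' := by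
  cases κ <;> rfl

end Profiles

section Mono
variable {S Λ Υ V : Type*} [Fintype S] [Fintype Λ] [Fintype Υ] [Fintype V] [DecidableEq V]

omit L in
/-- **the majorant graph value is monotone in its (nonnegative) majorants.** [folklore] -/
theorem graphValLS_mono (src tgt : Λ → V) (vtx : Υ → V) {ω : ℝ} (hω : 0 ≤ ω) (P P' : Λ → S → S → ℝ) (p p' : Υ → S → ℝ)
    (hP0 : ∀ ℓ x y, 0 ≤ P ℓ x y) (hPP : ∀ ℓ x y, P ℓ x y ≤ P' ℓ x y) (hp0 : ∀ υ x, 0 ≤ p υ x) (hpp : ∀ υ x, p υ x ≤ p' υ x) :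
    graphValLS ω src tgt P vtx p ≤ graphValLS ω src tgt P' vtx p' := by
  unfold graphValLS
  refine sum_le_sum fun σ _ => mul_le_mul_of_nonneg_left ?_ (pow_nonneg hω _)
  exact mul_le_mul (prod_le_prod (fun ℓ _ => hP0 _ _ _) fun ℓ _ => hPP _ _ _) (prod_le_prod (fun υ _ => hp0 _ _) fun υ _ => hpp _ _)
    (prod_nonneg fun υ _ => hp0 _ _) (prod_nonneg fun ℓ _ => (hP0 _ _ _).trans (hPP _ _ _))

end Mono


end Summit.QuantumFields.YangMills.BalabanUVNodes.N15KingModelRung.Curved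

end
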